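import Mathlib
import Summits.Ventures.PercRepro2.SwOutMixedArmsPlusDefs

/-!
# The core cube under AL⁺, with pieces: the uniform points (blind cell PercRepro2, night-4 g21,
2026-08-27; proofs/NIGHT4-G21.md §6)

The uniform points of a slice, `(s, C ∘ arm, C, C, f₀)`, are parametrised by the cube
`Config (ι ⊕ ρ)` (`toPtA`).  With pieces the red set of a BOTTOM uniform point is not empty (its
pieces), so the cube principle is applied to the modified function `ERp x = ER (toPtA x)` if `x`
has a red u-arm and `∅` otherwise — monotone, and its value at the flip of a top cube point is `∅`,
so no phantom term survives on the right.  On the down-closure `MtA` of the cube projections of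
the points of `Q` with a red u-arm (a lower set), whose points with a blue u-arm are realised in
`Q` by their uniform points (`mem_uniform_of_red`), the cube principle gives the inequality
«core-top + mixed ≤ mixed + bottom-core» (`diag_stepA`), the twin of `diag_step` for pieces.
-/

namespace Summit.Ventures.PercRepro2

namespace MixedArms

open scoped Classical

variable {ι ρ ν κ : Type*}

section CoreVocab

variable {arm : ν → ρ}

/-- The uniform point of a cube point on the slice `f₀`. -/
def toPtA (arm : ν → ρ) (f₀ : Config κ) (x : Config (ι ⊕ ρ)) : PtR ι ρ ν κ :=
  uniformPt arm (xs x) (xC x) f₀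

/-- The cube projection of the uniform point is the cube point. -/
lemma projCube_toPtA (f₀ : Config κ) (x : Config (ι ⊕ ρ)) :
    projCube (toPtA arm f₀ x) = x := cubePt_xs_xC x

/-- The uniform point of the cube projection of a core point on the slice is the point. -/
lemma toPtA_projCube {f₀ : Config κ} {q : PtR ι ρ ν κ} (hc : Core q arm)
    (hf : q.2.2.2.2 = f₀) : toPtA arm f₀ (projCube q) = q := by
  obtain ⟨s, a, uP, e, f⟩ := q
  obtain ⟨ha, he⟩ := hc
  simp only at ha he hf
  subst hf
  have ha' : a = fun i => uP (arm i) := funext ha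
  have he' : e = uP := (funext he).symm
  subst ha' he'
  rfl

/-- The uniform point is monotone in the cube point. -/
lemma toPtA_mono (f₀ : Config κ) {x y : Config (ι ⊕ ρ)} (h : x ≤ y) :
    toPtA arm f₀ x ≤ toPtA arm f₀ y :=
  ⟨fun _ => h _, fun i => h (Sum.inr (arm i)), fun _ => h _, fun _ => h _, le_rfl⟩

/-- The `f`-frozen flip of the uniform point is the uniform point of the flipped cube point. -/
lemma flipT_empty_toPtA [DecidableEq κ] (f₀ : Config κ) (x : Config (ι ⊕ ρ)) :
    flipT ∅ (toPtA arm f₀ x) = toPtA arm f₀ (flipAll x) := by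
  simp only [flipT, toPtA, uniformPt, Prod.mk.injEq]
  refine ⟨rfl, rfl, rfl, rfl, ?_⟩
  funext k
  simp only [Finset.notMem_empty, if_false]

/-- The `f`-frozen blue set of the uniform point. -/
lemma EBT_toPtA [DecidableEq κ] (f₀ : Config κ) (x : Config (ι ⊕ ρ)) :
    EBT ∅ (toPtA arm f₀ x) = ER (toPtA arm f₀ (flipAll x)) := by
  unfold EBT
  rw [flipT_empty_toPtA]

/-- A uniform point has a red u-arm iff its cube point has. -/
lemma red_toPtA_iff (f₀ : Config κ) (x : Config (ι ⊕ ρ)) :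
    (∃ j, (toPtA arm f₀ x).1 j = true) ↔ ∃ j, xs x j = true := Iff.rfl

/-- **The modified red set on the cube**: the red set of the uniform point when a u-arm is red,
empty otherwise. -/
def ERp (arm : ν → ρ) (f₀ : Config κ) (x : Config (ι ⊕ ρ)) : Set (AtomR ι ρ ν κ) :=
  if ∃ j, xs x j = true then ER (toPtA arm f₀ x) else ∅

/-- The modified red set at a cube point with a red u-arm. -/
lemma ERp_of_red (f₀ : Config κ) {x : Config (ι ⊕ ρ)} (hx : ∃ j, xs x j = true) :
    ERp arm f₀ x = ER (toPtA arm f₀ x) := if_pos hx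

/-- The modified red set at a cube point without a red u-arm. -/
lemma ERp_of_not_red (f₀ : Config κ) {x : Config (ι ⊕ ρ)} (hx : ¬ ∃ j, xs x j = true) :
    ERp arm f₀ x = ∅ := if_neg hx

/-- The modified red set is monotone. -/
lemma ERp_mono (f₀ : Config κ) : Monotone (ERp arm f₀ : Config (ι ⊕ ρ) → Set (AtomR ι ρ ν κ)) := by
  intro x y hxy
  unfold ERp
  split_ifs with hx hy
  · exact ER_mono (toPtA_mono f₀ hxy)
  · exfalso
    obtain ⟨j, hj⟩ := hx
    exact hy ⟨j, Bool.le_iff_imp.1 (hxy (Sum.inl j)) hj⟩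
  · exact Set.empty_subset _
  · exact le_rfl

end CoreVocab

section LowerSetA

variable {arm : ν → ρ} {Q : Set (PtR ι ρ ν κ)}

/-- The down-closure in the cube of the points of `Q` on the slice with a red u-arm. -/
def MtA (Q : Set (PtR ι ρ ν κ)) (arm : ν → ρ) (f₀ : Config κ) : Set (Config (ι ⊕ ρ)) :=
  {x | ∃ q, q ∈ Q ∧ ¬ Leak q arm ∧ (∃ j, q.1 j = true) ∧ q.2.2.2.2 = f₀ ∧ x ≤ projCube q}

/-- The down-closure is a lower set. -/
lemma isLowerSet_MtA (f₀ : Config κ) : IsLowerSet (MtA Q arm f₀) := by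
  rintro x y hle ⟨q, hq, hL, hs, hf, hxq⟩
  exact ⟨q, hq, hL, hs, hf, le_trans hle hxq⟩

/-- A cube point of the down-closure with a blue u-arm is realised in `Q` by its uniform point. -/
lemma toPtA_mem_of_MtA (hP : ArmLowerPlus arm Q) {f₀ : Config κ} {x : Config (ι ⊕ ρ)}
    (hx : x ∈ MtA Q arm f₀) (hs' : ∃ j, xs x j = false) : toPtA arm f₀ x ∈ Q := by
  obtain ⟨q, hq, hqL, hs, hf, hxq⟩ := hx
  exact mem_uniform_of_red hP hq hqL hs (fun j => hxq (Sum.inl j)) (fun r => hxq (Sum.inr r))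
    (le_of_eq hf.symm) hs'

variable [Fintype ι] [DecidableEq ι] [Fintype ρ] [DecidableEq ρ] [Fintype ν] [DecidableEq ν]
  [Fintype κ] [DecidableEq κ]

omit [Fintype ν] [DecidableEq ν] [Fintype κ] [DecidableEq κ] in
/-- **The cube principle on the down-closure with the modified red set.** -/
lemma cube_stepA (f₀ : Config κ) {𝓔 : Set (Set (AtomR ι ρ ν κ))} (h𝓔 : IsUpperSet 𝓔) :
    N (fun x : Config (ι ⊕ ρ) => x ∈ MtA Q arm f₀ ∧ ERp arm f₀ x ∈ 𝓔) ≤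
      N (fun x : Config (ι ⊕ ρ) => x ∈ MtA Q arm f₀ ∧ ERp arm f₀ (flipAll x) ∈ 𝓔) := by
  have hA : IsUpperSet {x : Config (ι ⊕ ρ) | ERp arm f₀ x ∈ 𝓔} := by
    intro x y hle hx
    exact h𝓔 (ERp_mono f₀ hle) hx
  have hB : IsLowerSet {x : Config (ι ⊕ ρ) | ERp arm f₀ (flipAll x) ∈ 𝓔} := by
    intro x y hle hx
    exact h𝓔 (ERp_mono f₀ (MixedCube.flipAll_le_flipAll' hle)) hx
  have hAB : flipAll ⁻¹' {x : Config (ι ⊕ ρ) | ERp arm f₀ (flipAll x) ∈ 𝓔} =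
      {x : Config (ι ⊕ ρ) | ERp arm f₀ x ∈ 𝓔} := by
    ext x
    simp only [Set.mem_preimage, Set.mem_setOf_eq, flipAll_involutive x]
  have key := LocRows.card_inter_le_of_cube (isLowerSet_MtA (Q := Q) (arm := arm) f₀) hA hB hAB
  have e1 : N (fun x : Config (ι ⊕ ρ) => x ∈ MtA Q arm f₀ ∧ ERp arm f₀ x ∈ 𝓔) =
      (Finset.univ.filter (· ∈ MtA Q arm f₀ ∩
        {x : Config (ι ⊕ ρ) | ERp arm f₀ x ∈ 𝓔})).card := by
    unfold N
    congr 1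
    ext x
    simp only [Finset.mem_filter, Finset.mem_univ, true_and, Set.mem_inter_iff, Set.mem_setOf_eq]
  have e2 : N (fun x : Config (ι ⊕ ρ) => x ∈ MtA Q arm f₀ ∧ ERp arm f₀ (flipAll x) ∈ 𝓔) =
      (Finset.univ.filter (· ∈ MtA Q arm f₀ ∩
        {x : Config (ι ⊕ ρ) | ERp arm f₀ (flipAll x) ∈ 𝓔})).card := by
    unfold N
    congr 1
    ext x
    simp only [Finset.mem_filter, Finset.mem_univ, true_and, Set.mem_inter_iff, Set.mem_setOf_eq]
  rw [e1, e2]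
  exact key

/-- **The core step with pieces**: the core points with a red u-arm are counted, through the cube
principle on the down-closure, by the core points with a blue u-arm (the mixed points and the
bottom core). -/
lemma diag_stepA (hP : ArmLowerPlus arm Q) (f₀ : Config κ) {𝓔 : Set (Set (AtomR ι ρ ν κ))}
    (h𝓔 : IsUpperSet 𝓔) (h0 : (∅ : Set (AtomR ι ρ ν κ)) ∉ 𝓔) :
    N (fun q : PtR ι ρ ν κ => (q ∈ Q ∧ ¬ Leak q arm ∧ q.2.2.2.2 = f₀ ∧ ER q ∈ 𝓔) ∧
        (∃ j, q.1 j = true) ∧ Core q arm) ≤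
      N (fun q : PtR ι ρ ν κ => (q ∈ Q ∧ ¬ Leak q arm ∧ q.2.2.2.2 = f₀ ∧ EBT ∅ q ∈ 𝓔) ∧
        (∃ j, q.1 j = false) ∧ Core q arm) := by
  refine le_trans ?_ (le_trans (cube_stepA (Q := Q) (arm := arm) f₀ h𝓔) ?_)
  · -- into the cube
    refine N_le_of_inj projCube (fun q hq => ?_) (fun q q' hq hq' hqq' => ?_)
    · obtain ⟨⟨hQ, hL', hf, hE⟩, hs, hc⟩ := hq
      refine ⟨⟨q, hQ, hL', hs, hf, le_rfl⟩, ?_⟩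
      rw [ERp_of_red f₀ hs, toPtA_projCube hc hf]
      exact hE
    · obtain ⟨⟨-, -, hf, -⟩, -, hc⟩ := hq
      obtain ⟨⟨-, -, hf', -⟩, -, hc'⟩ := hq'
      rw [← toPtA_projCube hc hf, ← toPtA_projCube hc' hf', hqq']
  · -- out of the cube
    refine N_le_of_inj (toPtA arm f₀) (fun x hx => ?_) (fun x x' _ _ hxx' => ?_)
    · obtain ⟨hM, hE⟩ := hx
      have hr : ∃ j, xs (flipAll x) j = true := by
        by_contra hc
        rw [ERp_of_not_red f₀ hc] at hE
        exact h0 hE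
      have hs' : ∃ j, xs x j = false := by
        obtain ⟨j, hj⟩ := hr
        exact ⟨j, by simpa [xs, flipAll] using hj⟩
      refine ⟨⟨toPtA_mem_of_MtA hP hM hs', not_leak_uniformPt _ _ _, rfl, ?_⟩, hs',
        core_uniformPt _ _ _⟩
      rw [EBT_toPtA, ← ERp_of_red f₀ hr]
      exact hE
    · rw [← projCube_toPtA (arm := arm) f₀ x, ← projCube_toPtA (arm := arm) f₀ x', hxx']

end LowerSetA

end MixedArms

end Summit.Ventures.PercRepro2
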